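import Summits.HodgeConjecture.CorCM.GaloisCyclicSemidirectEightDegenerate
import Mathlib.NumberTheory.LegendreSymbol.AddCharacter
import Mathlib.RingTheory.RootsOfUnity.Complex
import HarnessLib

/-!
# `C_p ⋊ C₈` is BAD whenever `ℤ/p` carries a DIFFERENCE PAIR

COR-CM (cell `pub-hodgecm2`), binder seat b04 (gen 28), count-neutral claim CYCLIC-SEMIDIRECT-EIGHT-DEGENERATE, part III.  KERNEL
ONLY: theorems; no definition, no named fact, no `sorry`.  `HC_CM` is neither used nor claimed.

A **difference pair** in `ℤ/p` is a pair of subsets `S ∉ {∅, ℤ/p}`, `S′` with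
  `#{(a,b) ∈ S′ × S′ : a − b = d} − 2·#{(a,b) ∈ S × S : a − b = d} = |S′| − 2|S|`  for every `d`
(automatic at `d = 0`; for `d ≠ 0`: the difference function of `S′` is twice that of `S` up to a constant); equivalently
`S′(ζ)S′(ζ⁻¹) = 2 S(ζ)S(ζ⁻¹)` at every primitive `p`-th root of unity (`S(ζ) = Σ_{v∈S} ζ^v`).  On `G₀ = C_p ⋊ C₈` (`φ(1)` =
inversion, `c₀ = y⁴`) the pair defines the CM set `T(S, S′) = {⟨v, s⟩ : P([v ∈ S], [v ∈ S′], s)}` (part II §3) — two SHEETS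
`ε₀ = 1 − 2·𝟙_S` (values `±1`) and `ε₁ = 1 + (i − 1)·𝟙_{S′}` (values `1, i`) — with trivial left stabiliser (this uses only
`S ≠ ∅, ℤ/p`: an even stabilising element would make `S` translation-stable, an odd one is caught on the constant sheet `s = 3`).
For the odd character `χ₀(t, v) = iᵗ ζᵛ` of `ℤ/4 × ℤ/p` the sheets `S₁ = {0,1} × Sᶜ ∪ {2,3} × S`, `S₂ = {0} × S′ᶜ ∪ {1} × ℤ/p ∪
{2} × S′` have sums `Ŝ₁(χ₀) = −2(1+i)·S(ζ)`, `Ŝ₂(χ₀) = −2·S′(ζ)` (and the `ζ ↦ ζ⁻¹` twists), so the two-sheet determinant is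
`Δ(χ₀) = 4i·(2 S(ζ)S(ζ⁻¹) − S′(ζ)S′(ζ⁻¹)) = 4i·(2|S| − |S′|)·Σ_d ζ^d = 0`: a SINGULAR odd block, and part II
(`exists_simple_degenerate_of_singular_block`) gives **a simple DEGENERATE CM abelian `4p`-fold with CM by `K`,
`Gal(K/ℚ) ≅ C_p ⋊ C₈`**, with an exceptional Hodge class on a power (`exists_simple_degenerate_of_differencePair`).  Instances
(`C₇`, `C₂₃`, `C₃₁ ⋊ C₈`, by `decide` on `ℤ/p` alone) follow in part IV.  ARITHMETIC: a difference pair forces the primes of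
`ℚ(ζ_p)⁺` above `2` to split in `ℚ(ζ_p)` (`ord_p 2` odd — automatic for `p ≡ 7 (mod 8)`, false for `p = 17, 19, 41`) and
`(|S|, |S′|) = (B(A − 2B), (p − |A² − 4AB + 2B²|)/2)` for some `p = A² − 2B²`; for `p ≡ 5 (mod 8)` (`C_p ⋊ C₈` GOOD,
`CorCM/GaloisCyclicSemidirectEightNondegenerate`) `i` is not even a local norm and no pair exists.

## References

* [Kubota1965] T. Kubota, *On the field extension by complex multiplication*, Trans. AMS 118 (1965), §2, §4 Lemma 2.
* [Shimura1998] G. Shimura, *Abelian Varieties with Complex Multiplication and Modular Functions*, §6.2 Thm. 3, §8.2 Prop. 26.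
* [Gordon1999HodgeAVSurvey] B. B. Gordon, *A survey of the Hodge conjecture for abelian varieties*, Thm. 6.4, §9.3, Prop. 9.4.1.
-/

noncomputable section

open CategoryTheory CategoryTheory.Limits NumberField
open scoped BigOperators

namespace Summit.HodgeConjecture.CorCM.GaloisCyclicSemidirectEight

open Literature.NumberTheory.ComplexMultiplication
open Literature.AlgebraicGeometry.Motives (AbelianVariety CMType)
open Literature.AlgebraicGeometry.HodgeTheory
open Literature.AlgebraicGeometry.ComplexMultiplication (IsCMTypeRealisation)
open Literature.AlgebraicGeometry.Pohlmann1968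
open Literature.Barriers.HodgeConjecture (divisorClassesSpan)
open AddChar
open Multiplicative (ofAdd toAdd)

/-! ## The theorem -/

section Field

variable {p : ℕ} [Fact p.Prime]
variable {K : Type} [Field K] [NumberField K] [IsCMField K] [IsGalois ℚ K]

/-- **A DIFFERENCE PAIR IN `ℤ/p` MAKES `C_p ⋊ C₈` BAD.**  `e : Gal(K/ℚ) ≃* C_p ⋊ C₈` (`φ(1)` = inversion, `p` an odd prime);
`S, S′ ⊆ ℤ/p` with `S ≠ ∅`, `S ≠ ℤ/p` and `#{(a,b) ∈ S′²: a − b = d} + 2|S| = |S′| + 2·#{(a,b) ∈ S²: a − b = d}` for every `d`.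
Then `K` has a PRIMITIVE DEGENERATE CM type, realised by a SIMPLE abelian variety of dimension `4p` with CM by `K` and a
rational `(q,q)` class outside the divisor ring on some power.  (Sheets `ε₀ = 1 − 2·𝟙_S`, `ε₁ = 1 + (i−1)𝟙_{S′}`; singular
block at `χ₀ = (iᵗ ζᵛ)`.) [cite: Kubota1965, §2 and §4 Lemma 2] [cite: Shimura1998, §6.2 Thm. 3 and §8.2 Prop. 26]
[cite: Gordon1999HodgeAVSurvey, Thm. 6.4 and §9.3] -/
theorem exists_simple_degenerate_of_differencePair (hp2 : p ≠ 2)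
    (φ : Multiplicative (ZMod 8) →* MulAut (Multiplicative (ZMod p)))
    (hφ : ∀ v : Multiplicative (ZMod p), φ (ofAdd 1) v = v⁻¹)
    (e : (K ≃ₐ[ℚ] K) ≃* Multiplicative (ZMod p) ⋊[φ] Multiplicative (ZMod 8))
    (S S' : Finset (ZMod p)) (hS0 : S.Nonempty) (hS1 : ∃ u, u ∉ S)
    (hpair : ∀ d : ZMod p, ((S' ×ˢ S').filter (fun ab => ab.1 - ab.2 = d)).card + 2 * S.card =
      S'.card + 2 * ((S ×ˢ S).filter (fun ab => ab.1 - ab.2 = d)).card) :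
    ∃ (Φ : CMType K) (φ₀ : K →+* ℂ) (A : AbelianVariety ℂ) (ι : 𝓞 K →+* End A)
      (θ : K →+* Module.End ℂ (complexBetti A.X 1)),
      IsPrimitive (ℂ ≃+* ℂ) Φ.1 φ₀ ∧ ¬ IsNondegenerate Φ ∧ IsCMTypeRealisation Φ A ι θ ∧ A.IsSimple ∧ A.dim = 4 * p ∧
      ∃ n q : ℕ, ∃ x : complexBetti (⨁ fun _ : Fin n => A).X (2 * q), IsRationalClass x ∧
        IsOfHodgeType (⨁ fun _ : Fin n => A).dim (⨁ fun _ : Fin n => A).X (2 * q) q q x ∧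
        x ∉ divisorClassesSpan (⨁ fun _ : Fin n => A).X (⨁ fun _ : Fin n => A).dim q := by
  classical
  have hp : p.Prime := Fact.out
  haveI : NeZero p := ⟨hp.ne_zero⟩
  haveI : Fact (1 < p) := ⟨hp.one_lt⟩
  haveI : Fintype (Multiplicative (ZMod p) ⋊[φ] Multiplicative (ZMod 8)) :=
    Fintype.ofEquiv _ SemidirectProduct.equivProd.symm
  have h2 : (2 : ZMod p) ≠ 0 := by
    rw [Ne, show (2 : ZMod p) = ((2 : ℕ) : ZMod p) by norm_num, ZMod.natCast_eq_zero_iff]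
    intro h
    exact hp2 ((Nat.prime_dvd_prime_iff_eq hp Nat.prime_two).1 h)
  obtain ⟨u₁, hu₁⟩ := hS0
  obtain ⟨u₀, hu₀⟩ := hS1
  -- the CM set `T(S, S')`
  set T : Finset (Multiplicative (ZMod p) ⋊[φ] Multiplicative (ZMod 8)) := Finset.univ.filter fun g =>
    ((toAdd g.right = 0 ∨ toAdd g.right = 2) ∧ decide (toAdd g.left ∈ S) = false ∨
        (toAdd g.right = 4 ∨ toAdd g.right = 6) ∧ decide (toAdd g.left ∈ S) = true ∨
        toAdd g.right = 1 ∧ decide (toAdd g.left ∈ S') = false ∨ toAdd g.right = 3 ∨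
        toAdd g.right = 5 ∧ decide (toAdd g.left ∈ S') = true)
    with hT_def
  have hT : ∀ g, g ∈ T ↔
      ((toAdd g.right = 0 ∨ toAdd g.right = 2) ∧ decide (toAdd g.left ∈ S) = false ∨
          (toAdd g.right = 4 ∨ toAdd g.right = 6) ∧ decide (toAdd g.left ∈ S) = true ∨
          toAdd g.right = 1 ∧ decide (toAdd g.left ∈ S') = false ∨ toAdd g.right = 3 ∨
          toAdd g.right = 5 ∧ decide (toAdd g.left ∈ S') = true) :=
    fun g => by
    rw [hT_def, Finset.mem_filter]
    simp only [Finset.mem_univ, true_and]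
  have hT' : ∀ (a : Multiplicative (ZMod p)) (b : Multiplicative (ZMod 8)),
      (⟨a, b⟩ : Multiplicative (ZMod p) ⋊[φ] Multiplicative (ZMod 8)) ∈ T ↔
      ((toAdd b = 0 ∨ toAdd b = 2) ∧ decide (toAdd a ∈ S) = false ∨
          (toAdd b = 4 ∨ toAdd b = 6) ∧ decide (toAdd a ∈ S) = true ∨
          toAdd b = 1 ∧ decide (toAdd a ∈ S') = false ∨ toAdd b = 3 ∨
          toAdd b = 5 ∧ decide (toAdd a ∈ S') = true) :=
    fun a b => hT ⟨a, b⟩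
  -- the action: even elements act trivially, odd ones invert
  have hφe : ∀ (k : ℕ) (x : Multiplicative (ZMod p)), φ (ofAdd (2 : ZMod 8) ^ k) x = x :=
    phi_two_pow φ hφ
  have hφo : ∀ (k : ℕ) (x : Multiplicative (ZMod p)),
      φ (ofAdd (2 : ZMod 8) ^ k * ofAdd 1) x = x⁻¹ := fun k x => by
    rw [map_mul, MulAut.mul_apply, hφ, hφe]
  have hdecomp : ∀ m : Multiplicative (ZMod 8), m = ofAdd (2 : ZMod 8) ^ ((toAdd m).val / 2) *
      ofAdd (1 : ZMod 8) ^ ((toAdd m).val % 2) := fun m => by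
    set n : ℕ := (toAdd m).val with hn_def
    rw [← ofAdd_nsmul, ← ofAdd_nsmul, ← ofAdd_add, nsmul_eq_mul, nsmul_eq_mul]
    conv_lhs => rw [← ofAdd_toAdd m, ← ZMod.natCast_zmod_val (toAdd m)]
    rw [← hn_def]
    conv_lhs => rw [← Nat.div_add_mod n 2]
    congr 1
    push_cast
    ring
  -- (a) CM set for `c₀ = inr 4`
  have h4 : ofAdd (4 : ZMod 8) = ofAdd (2 : ZMod 8) ^ 2 := by decide
  have hc₀mul : ∀ g : Multiplicative (ZMod p) ⋊[φ] Multiplicative (ZMod 8),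
      (SemidirectProduct.inr (ofAdd (4 : ZMod 8)) * g).left = g.left ∧
      toAdd (SemidirectProduct.inr (ofAdd (4 : ZMod 8)) * g).right =
        4 + toAdd g.right := fun g => by
    constructor
    · rw [SemidirectProduct.mul_left, SemidirectProduct.left_inr, SemidirectProduct.right_inr, one_mul, h4, hφe]
    · rw [SemidirectProduct.mul_right, SemidirectProduct.right_inr, toAdd_mul, toAdd_ofAdd]
  have hScm : ∀ g, g ∈ T ↔ SemidirectProduct.inr (ofAdd (4 : ZMod 8)) * g ∉ T := fun g => by
    rw [hT, hT, (hc₀mul g).1, (hc₀mul g).2, pairPred_four_add, not_not]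
  -- (b) trivial left stabiliser
  have hprim : ∀ g : Multiplicative (ZMod p) ⋊[φ] Multiplicative (ZMod 8), g ≠ 1 → ∃ w, ¬ (w ∈ T ↔ g * w ∈ T) := by
    rintro ⟨v₀, s₀⟩ hg
    have hm := hdecomp s₀
    rcases Nat.mod_two_eq_zero_or_one (toAdd s₀).val with h0 | h1
    · -- even `s₀`: `φ s₀ = id`
      have hφs : ∀ x, φ s₀ x = x := fun x => by rw [hm, h0, pow_zero, mul_one, hφe]
      have hmul : ∀ (x : Multiplicative (ZMod p)) (s : Multiplicative (ZMod 8)),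
          (⟨v₀, s₀⟩ * ⟨x, s⟩ : Multiplicative (ZMod p) ⋊[φ] Multiplicative (ZMod 8)) = ⟨v₀ * x, s₀ * s⟩ := fun x s => by
        refine SemidirectProduct.ext ?_ ?_
        · rw [SemidirectProduct.mul_left]
          show v₀ * φ s₀ x = v₀ * x
          rw [hφs]
        · rw [SemidirectProduct.mul_right]
      by_cases hv : v₀ = 1
      · subst hv
        have hs : toAdd s₀ ≠ 0 := fun h => hg (by
          have : s₀ = 1 := by rw [← ofAdd_toAdd s₀, h]; rfl
          subst this; rfl)
        obtain ⟨k, hk0, hk1⟩ := pairPred_even_witness _ h0 hs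
        refine ⟨⟨ofAdd u₀, ofAdd k⟩, fun hiff => ?_⟩
        have hw : (⟨ofAdd u₀, ofAdd k⟩ :
            Multiplicative (ZMod p) ⋊[φ] Multiplicative (ZMod 8)) ∈ T := by
          rw [hT', toAdd_ofAdd, toAdd_ofAdd, hk0]
          exact decide_eq_false hu₀
        have hgw := hiff.1 hw
        rw [hmul, one_mul, hT', toAdd_ofAdd, toAdd_mul, toAdd_ofAdd, hk1, decide_eq_true_eq] at hgw
        exact hu₀ hgw
      · have hv' : toAdd v₀ ≠ 0 := fun h => hv (by rw [← ofAdd_toAdd v₀, h]; rfl)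
        by_contra hall
        push Not at hall
        -- `hall : ∀ w, w ∈ T ↔ g w ∈ T`; read it on `w = ⟨x, 0⟩`
        have hread : ∀ x : ZMod p, (decide (x ∈ S) = false ↔
            ((toAdd s₀ = 0 ∨ toAdd s₀ = 2) ∧ decide (toAdd v₀ + x ∈ S) = false ∨
                (toAdd s₀ = 4 ∨ toAdd s₀ = 6) ∧ decide (toAdd v₀ + x ∈ S) = true ∨
                toAdd s₀ = 1 ∧ decide (toAdd v₀ + x ∈ S') = false ∨ toAdd s₀ = 3 ∨
                toAdd s₀ = 5 ∧ decide (toAdd v₀ + x ∈ S') = true)) :=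
          fun x => by
          have h := hall ⟨ofAdd x, 1⟩
          rw [hmul, mul_one, hT', hT', toAdd_one, toAdd_mul, toAdd_ofAdd, (pairPred_zero_three _ _).1] at h
          exact h
        rcases pairPred_even _ h0 with hcase | hcase
        · -- `S` is stable under `x ↦ v₀ + x`
          have hstab : ∀ x, x ∈ S ↔ toAdd v₀ + x ∈ S := fun x => by
            have h := hread x
            rw [hcase, decide_eq_false_iff_not, decide_eq_false_iff_not, not_iff_not] at h
            exact h
          rcases eq_empty_or_eq_univ_of_forall_mem_iff_add_mem S hv' hstab with h | h
          · rw [h] at hu₁; simp at hu₁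
          · rw [h] at hu₀; simp at hu₀
        · -- `S` is stable under `x ↦ 2 v₀ + x`
          have hflip : ∀ x, x ∉ S ↔ toAdd v₀ + x ∈ S := fun x => by
            have h := hread x
            rw [hcase, decide_eq_false_iff_not, decide_eq_true_eq] at h
            exact h
          have hstab : ∀ x, x ∈ S ↔ 2 * toAdd v₀ + x ∈ S := fun x => by
            have h1 := hflip x
            have h2 := hflip (toAdd v₀ + x)
            rw [two_mul, add_assoc, ← h2]
            tauto
          rcases eq_empty_or_eq_univ_of_forall_mem_iff_add_mem S (mul_ne_zero h2 hv') hstab with h | h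
          · rw [h] at hu₁; simp at hu₁
          · rw [h] at hu₀; simp at hu₀
    · -- odd `s₀`: `φ s₀ = inv`; witnesses on the sheet `s = 3`
      have hφs : ∀ x, φ s₀ x = x⁻¹ := fun x => by rw [hm, h1, pow_one, hφo]
      have hmul : ∀ u : ZMod p, ((⟨v₀, s₀⟩ : Multiplicative (ZMod p) ⋊[φ] Multiplicative (ZMod 8)) *
            ⟨v₀ * (ofAdd u)⁻¹, ofAdd 3⟩) =
          ⟨ofAdd u, s₀ * ofAdd 3⟩ := fun u => by
        refine SemidirectProduct.ext ?_ ?_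
        · rw [SemidirectProduct.mul_left]
          show v₀ * φ s₀ (v₀ * (ofAdd u)⁻¹) = ofAdd u
          rw [hφs, mul_inv_rev, inv_inv, mul_comm (ofAdd u), mul_inv_cancel_left]
        · rw [SemidirectProduct.mul_right]
      have key : ∀ u : ZMod p, ((⟨v₀ * (ofAdd u)⁻¹, ofAdd 3⟩ :
            Multiplicative (ZMod p) ⋊[φ] Multiplicative (ZMod 8)) ∈ T) ∧
          (((⟨v₀, s₀⟩ : Multiplicative (ZMod p) ⋊[φ] Multiplicative (ZMod 8)) *
              ⟨v₀ * (ofAdd u)⁻¹, ofAdd 3⟩ ∈ T) ↔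
            ((toAdd s₀ + 3 = 0 ∨ toAdd s₀ + 3 = 2) ∧ decide (u ∈ S) = false ∨
                (toAdd s₀ + 3 = 4 ∨ toAdd s₀ + 3 = 6) ∧ decide (u ∈ S) = true ∨
                toAdd s₀ + 3 = 1 ∧ decide (u ∈ S') = false ∨ toAdd s₀ + 3 = 3 ∨
                toAdd s₀ + 3 = 5 ∧ decide (u ∈ S') = true)) := fun u => by
        constructor
        · rw [hT', toAdd_ofAdd]
          exact (pairPred_zero_three _ _).2
        · rw [hmul, hT', toAdd_ofAdd, toAdd_mul, toAdd_ofAdd]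
      rcases pairPred_odd_add_three _ h1 with hcase | hcase
      · refine ⟨⟨v₀ * (ofAdd u₀)⁻¹, ofAdd 3⟩, fun hiff => ?_⟩
        have h := hiff.1 (key u₀).1
        rw [(key u₀).2, hcase, decide_eq_true_eq] at h
        exact hu₀ h
      · refine ⟨⟨v₀ * (ofAdd u₁)⁻¹, ofAdd 3⟩, fun hiff => ?_⟩
        have h := hiff.1 (key u₁).1
        rw [(key u₁).2, hcase, decide_eq_false_iff_not] at h
        exact h hu₁
  -- (c) the sheets of `T` on `ℤ/4 × ℤ/p`
  set MS : Finset (Multiplicative (ZMod p)) := S.map ofAdd.toEmbedding with hMS_def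
  set NS : Finset (Multiplicative (ZMod p)) := Sᶜ.map ofAdd.toEmbedding with hNS_def
  set MS' : Finset (Multiplicative (ZMod p)) := S'.map ofAdd.toEmbedding with hMS'_def
  set NS' : Finset (Multiplicative (ZMod p)) := S'ᶜ.map ofAdd.toEmbedding with hNS'_def
  set T01 : Finset (Multiplicative (ZMod 4)) := {ofAdd 0, ofAdd 1} with hT01_def
  set T23 : Finset (Multiplicative (ZMod 4)) := {ofAdd 2, ofAdd 3} with hT23_def
  set S₁ : Finset (Multiplicative (ZMod 4) × Multiplicative (ZMod p)) := T01 ×ˢ NS ∪ T23 ×ˢ MS with hS₁_def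
  set S₂ : Finset (Multiplicative (ZMod 4) × Multiplicative (ZMod p)) :=
    ({ofAdd 0} ×ˢ NS' ∪ {ofAdd 1} ×ˢ Finset.univ) ∪ {ofAdd 2} ×ˢ MS'
    with hS₂_def
  have hpow2 : ∀ k : ℕ, ofAdd (2 : ZMod 8) ^ k = ofAdd ((2 * k : ℕ) : ZMod 8) :=
    fun k => by rw [← ofAdd_nsmul, nsmul_eq_mul, Nat.cast_mul, Nat.cast_ofNat, mul_comm]
  have htoAdd2 : ∀ k : ℕ, toAdd (ofAdd (2 : ZMod 8) ^ k) = ((2 * k : ℕ) : ZMod 8) :=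
    fun k => by rw [hpow2, toAdd_ofAdd]
  have htoAdd2' : ∀ k : ℕ, toAdd (ofAdd (2 : ZMod 8) ^ k * ofAdd 1) =
      ((2 * k + 1 : ℕ) : ZMod 8) := fun k => by
    rw [toAdd_mul, hpow2, toAdd_ofAdd, toAdd_ofAdd]; push_cast; ring
  have e4 : ∀ (t : Multiplicative (ZMod 4)) (k : ZMod 4), t = ofAdd k ↔ toAdd t = k :=
    fun t k => by
    constructor
    · rintro rfl; rfl
    · rintro rfl; rfl
  have hS₁ : ∀ (t : Multiplicative (ZMod 4)) (v : Multiplicative (ZMod p)), (t, v) ∈ S₁ ↔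
      (⟨v, ofAdd (2 : ZMod 8) ^ (toAdd t).val⟩ :
        Multiplicative (ZMod p) ⋊[φ] Multiplicative (ZMod 8)) ∈ T := fun t v => by
    rw [hT', htoAdd2, (pairPred_sheets (toAdd t) _ _).1]
    simp only [hS₁_def, hT01_def, hT23_def, hNS_def, hMS_def, Finset.mem_union, Finset.mem_product, Finset.mem_insert,
      Finset.mem_singleton, Finset.mem_map_equiv, Finset.mem_compl, Multiplicative.ofAdd_symm_eq, e4]
    by_cases hv : toAdd v ∈ S <;> simp [hv]
  have hy : ∀ (t : Multiplicative (ZMod 4)) (v : Multiplicative (ZMod p)),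
      (⟨v, ofAdd (2 : ZMod 8) ^ (toAdd t).val⟩ :
        Multiplicative (ZMod p) ⋊[φ] Multiplicative (ZMod 8)) * SemidirectProduct.inr (ofAdd (1 : ZMod 8)) =
      ⟨v, ofAdd (2 : ZMod 8) ^ (toAdd t).val * ofAdd 1⟩ := fun t v => by
    refine SemidirectProduct.ext ?_ ?_
    · rw [SemidirectProduct.mul_left, SemidirectProduct.left_inr, map_one, mul_one]
    · rw [SemidirectProduct.mul_right, SemidirectProduct.right_inr]
  have hS₂ : ∀ (t : Multiplicative (ZMod 4)) (v : Multiplicative (ZMod p)), (t, v) ∈ S₂ ↔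
      (⟨v, ofAdd (2 : ZMod 8) ^ (toAdd t).val⟩ :
        Multiplicative (ZMod p) ⋊[φ] Multiplicative (ZMod 8)) *
          SemidirectProduct.inr (ofAdd (1 : ZMod 8)) ∈ T := fun t v => by
    rw [hy, hT', htoAdd2', (pairPred_sheets (toAdd t) _ _).2]
    simp only [hS₂_def, hNS'_def, hMS'_def, Finset.mem_union, Finset.mem_product, Finset.mem_singleton,
      Finset.mem_map_equiv, Finset.mem_compl, Finset.mem_univ, and_true, Multiplicative.ofAdd_symm_eq, e4]
    by_cases hv : toAdd v ∈ S' <;> simp [hv]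
  -- (d) the odd character `χ₀ = (iᵗ ζᵛ)` and its sheet sums
  have hζ : IsPrimitiveRoot (Complex.exp (2 * Real.pi * Complex.I / p)) p := Complex.isPrimitiveRoot_exp p hp.ne_zero
  set ψp : AddChar (ZMod p) ℂ := AddChar.zmodChar p hζ.pow_eq_one with hψp_def
  have hψp1 : ψp ≠ 1 := by
    intro h
    have h1 : ψp 1 = 1 := by rw [h, AddChar.one_apply]
    rw [hψp_def, AddChar.zmodChar_apply, ZMod.val_one, pow_one] at h1
    exact hζ.ne_one hp.one_lt h1
  have hsumψ : ∑ a : ZMod p, ψp a = 0 := AddChar.sum_eq_zero_of_ne_one hψp1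
  have hsumψ' : ∑ a : ZMod p, ψp (-a) = 0 := by
    rw [← hsumψ]
    exact Fintype.sum_equiv (Equiv.neg _) _ _ fun a => rfl
  set ψ4 : AddChar (ZMod 4) ℂ := AddChar.zmodChar 4 Complex.I_pow_four with hψ4_def
  have hψ4v : ψ4 0 = 1 ∧ ψ4 1 = Complex.I ∧ ψ4 2 = -1 ∧ ψ4 3 = -Complex.I := by
    refine ⟨?_, ?_, ?_, ?_⟩ <;> rw [hψ4_def, AddChar.zmodChar_apply]
    · rw [ZMod.val_zero, pow_zero]
    · rw [show (1 : ZMod 4).val = 1 from rfl, pow_one]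
    · rw [show (2 : ZMod 4).val = 2 from rfl, Complex.I_sq]
    · rw [show (3 : ZMod 4).val = 3 from rfl, pow_succ, Complex.I_sq]; ring
  let χ₀ : AddChar (Additive (Multiplicative (ZMod 4) × Multiplicative (ZMod p))) ℂ :=
    { toFun := fun w => ψ4 (toAdd (Additive.toMul w).1) * ψp (toAdd (Additive.toMul w).2)
      map_zero_eq_one' := by simp
      map_add_eq_mul' := fun w w' => by
        simp only [toMul_add, Prod.fst_mul, Prod.snd_mul, toAdd_mul, map_add_eq_mul]; ring }
  have hχ₀ : ∀ (t : Multiplicative (ZMod 4)) (v : Multiplicative (ZMod p)),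
      χ₀ (Additive.ofMul (t, v)) = ψ4 (toAdd t) * ψp (toAdd v) := fun t v => rfl
  have hχc : χ₀ (Additive.ofMul (ofAdd (2 : ZMod 4), (1 : Multiplicative (ZMod p)))) = -1 := by
    rw [hχ₀, toAdd_ofAdd, toAdd_one, hψ4v.2.2.1, map_zero_eq_one, mul_one]
  have hχq : χ₀ (Additive.ofMul (ofAdd (1 : ZMod 4), (1 : Multiplicative (ZMod p)))) = Complex.I := by
    rw [hχ₀, toAdd_ofAdd, toAdd_one, hψ4v.2.1, map_zero_eq_one, mul_one]
  -- sums over the two sheets, for any second factor `η`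
  have h01 : ofAdd (0 : ZMod 4) ≠ ofAdd 1 := by decide
  have h23 : ofAdd (2 : ZMod 4) ≠ ofAdd 3 := by decide
  have hdisj₁ : Disjoint (T01 ×ˢ NS) (T23 ×ˢ MS) :=
    Finset.disjoint_product.2 (Or.inl (by rw [hT01_def, hT23_def]; decide))
  have hdisj₂ : Disjoint ({ofAdd (0 : ZMod 4)} ×ˢ NS') ({ofAdd (1 : ZMod 4)} ×ˢ
      (Finset.univ : Finset (Multiplicative (ZMod p)))) :=
    Finset.disjoint_product.2 (Or.inl (by decide))
  have hdisj₃ : Disjoint ({ofAdd (0 : ZMod 4)} ×ˢ NS' ∪ {ofAdd (1 : ZMod 4)} ×ˢ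
      (Finset.univ : Finset (Multiplicative (ZMod p)))) ({ofAdd (2 : ZMod 4)} ×ˢ MS') := by
    rw [Finset.disjoint_union_left]
    exact ⟨Finset.disjoint_product.2 (Or.inl (by decide)), Finset.disjoint_product.2 (Or.inl (by decide))⟩
  have hsum₁ : ∀ η : ZMod p → ℂ, ∑ w ∈ S₁, ψ4 (toAdd w.1) * η (toAdd w.2) =
      (1 + Complex.I) * (∑ v ∈ Sᶜ, η v) + (-1 - Complex.I) * ∑ v ∈ S, η v := fun η => by
    rw [hS₁_def, Finset.sum_union hdisj₁, Finset.sum_product, Finset.sum_product]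
    simp_rw [← Finset.mul_sum]
    rw [← Finset.sum_mul, ← Finset.sum_mul, hT01_def, hT23_def, Finset.sum_pair h01, Finset.sum_pair h23, hNS_def,
      hMS_def, Finset.sum_map, Finset.sum_map]
    simp only [toAdd_ofAdd, Equiv.coe_toEmbedding, hψ4v.1, hψ4v.2.1, hψ4v.2.2.1, hψ4v.2.2.2]
    ring
  have hsum₂ : ∀ η : ZMod p → ℂ, ∑ w ∈ S₂, ψ4 (toAdd w.1) * η (toAdd w.2) =
      (∑ v ∈ S'ᶜ, η v) + Complex.I * (∑ v : Multiplicative (ZMod p), η (toAdd v)) -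
        ∑ v ∈ S', η v := fun η => by
    rw [hS₂_def, Finset.sum_union hdisj₃, Finset.sum_union hdisj₂, Finset.sum_product, Finset.sum_product,
      Finset.sum_product]
    simp_rw [← Finset.mul_sum]
    rw [Finset.sum_singleton, Finset.sum_singleton, Finset.sum_singleton, hNS'_def, hMS'_def, Finset.sum_map,
      Finset.sum_map]
    simp only [toAdd_ofAdd, Equiv.coe_toEmbedding, hψ4v.1, hψ4v.2.1, hψ4v.2.2.1]
    ring
  -- complements and the four sheet sums
  have hc : ∀ (X : Finset (ZMod p)) (η : ZMod p → ℂ), (∑ v, η v) = 0 → ∑ v ∈ Xᶜ, η v = -∑ v ∈ X, η v :=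
    fun X η h => by
    have := Finset.sum_compl_add_sum X η
    rw [h] at this
    linear_combination this
  have huniv : ∀ η : ZMod p → ℂ, ∑ v : Multiplicative (ZMod p), η (toAdd v) = ∑ v, η v := fun η =>
    Fintype.sum_equiv toAdd _ _ fun _ => rfl
  have eA : ∑ s ∈ S₁, χ₀ (Additive.ofMul s) = ∑ w ∈ S₁, ψ4 (toAdd w.1) * ψp (toAdd w.2) :=
    Finset.sum_congr rfl fun w _ => hχ₀ w.1 w.2
  have eAθ : ∑ s ∈ S₁, χ₀ (Additive.ofMul (s.1, s.2⁻¹)) =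
      ∑ w ∈ S₁, ψ4 (toAdd w.1) * ψp (-toAdd w.2) :=
    Finset.sum_congr rfl fun w _ => by rw [hχ₀, toAdd_inv]
  have eB : ∑ t ∈ S₂, χ₀ (Additive.ofMul t) = ∑ w ∈ S₂, ψ4 (toAdd w.1) * ψp (toAdd w.2) :=
    Finset.sum_congr rfl fun w _ => hχ₀ w.1 w.2
  have eBθ : ∑ t ∈ S₂, χ₀ (Additive.ofMul (t.1, t.2⁻¹)) =
      ∑ w ∈ S₂, ψ4 (toAdd w.1) * ψp (-toAdd w.2) :=
    Finset.sum_congr rfl fun w _ => by rw [hχ₀, toAdd_inv]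
  have hA : ∑ s ∈ S₁, χ₀ (Additive.ofMul s) = -2 * (1 + Complex.I) * ∑ v ∈ S, ψp v := by
    rw [eA, hsum₁ (fun v => ψp v), hc S _ hsumψ]; ring
  have hAθ : ∑ s ∈ S₁, χ₀ (Additive.ofMul (s.1, s.2⁻¹)) = -2 * (1 + Complex.I) * ∑ v ∈ S, ψp (-v) := by
    rw [eAθ, hsum₁ (fun v => ψp (-v)), hc S _ hsumψ']; ring
  have hB : ∑ t ∈ S₂, χ₀ (Additive.ofMul t) = -2 * ∑ v ∈ S', ψp v := by
    rw [eB, hsum₂ (fun v => ψp v), huniv (fun v => ψp v), hsumψ, hc S' _ hsumψ]; ring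
  have hBθ : ∑ t ∈ S₂, χ₀ (Additive.ofMul (t.1, t.2⁻¹)) = -2 * ∑ v ∈ S', ψp (-v) := by
    rw [eBθ, hsum₂ (fun v => ψp (-v)), huniv (fun v => ψp (-v)), hsumψ', hc S' _ hsumψ']; ring
  -- (e) the difference-pair identity `S'(ζ)S'(ζ⁻¹) = 2 S(ζ)S(ζ⁻¹)`
  have hC : ∀ X : Finset (ZMod p), (∑ v ∈ X, ψp v) * (∑ v ∈ X, ψp (-v)) =
      ∑ d, (((X ×ˢ X).filter (fun ab => ab.1 - ab.2 = d)).card : ℂ) * ψp d := fun X => by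
    rw [Finset.sum_mul_sum, ← Finset.sum_product' (f := fun a b => ψp a * ψp (-b))]
    have e1 : ∀ x : ZMod p × ZMod p, ψp x.1 * ψp (-x.2) = ψp (x.1 - x.2) := fun x => by
      rw [sub_eq_add_neg, map_add_eq_mul]
    simp_rw [e1]
    rw [← Finset.sum_fiberwise' (X ×ˢ X) (fun ab => ab.1 - ab.2) (fun d => ψp d)]
    refine Finset.sum_congr rfl fun d _ => ?_
    rw [Finset.sum_const, nsmul_eq_mul]
  have hAB : (∑ v ∈ S', ψp v) * (∑ v ∈ S', ψp (-v)) = 2 * ((∑ v ∈ S, ψp v) * (∑ v ∈ S, ψp (-v))) := by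
    rw [hC, hC, Finset.mul_sum, ← sub_eq_zero, ← Finset.sum_sub_distrib]
    have e2 : ∀ d : ZMod p, (((S' ×ˢ S').filter (fun ab => ab.1 - ab.2 = d)).card : ℂ) * ψp d -
        2 * ((((S ×ˢ S).filter (fun ab => ab.1 - ab.2 = d)).card : ℂ) * ψp d) =
        ((S'.card : ℂ) - 2 * S.card) * ψp d := fun d => by
      have h : (((S' ×ˢ S').filter (fun ab => ab.1 - ab.2 = d)).card : ℂ) + 2 * (S.card : ℂ) =
          (S'.card : ℂ) + 2 * (((S ×ˢ S).filter (fun ab => ab.1 - ab.2 = d)).card : ℂ) := by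
        exact_mod_cast hpair d
      linear_combination ψp d * h
    simp_rw [e2]
    rw [← Finset.mul_sum, hsumψ, mul_zero]
  -- (f) the singular block
  have hΔ : (∑ s ∈ S₁, χ₀ (Additive.ofMul s)) * (∑ s ∈ S₁, χ₀ (Additive.ofMul (s.1, s.2⁻¹))) -
      χ₀ (Additive.ofMul (ofAdd (1 : ZMod 4), (1 : Multiplicative (ZMod p)))) *
        ((∑ t ∈ S₂, χ₀ (Additive.ofMul t)) * (∑ t ∈ S₂, χ₀ (Additive.ofMul (t.1, t.2⁻¹)))) = 0 := by
    rw [hA, hAθ, hB, hBθ, hχq]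
    linear_combination (-4 * Complex.I) * hAB + (4 * (∑ v ∈ S, ψp v) * (∑ v ∈ S, ψp (-v))) * Complex.I_sq
  exact exists_simple_degenerate_of_singular_block hp2 φ hφ e T hScm hprim S₁ S₂ (fun w => hS₁ w.1 w.2)
    (fun w => hS₂ w.1 w.2) χ₀ hχc hΔ

end Field

end Summit.HodgeConjecture.CorCM.GaloisCyclicSemidirectEight

end
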